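/-
Copyright: harness tree, Literature layer (sorry-free). b2b-lace enum1-g34 (ENUMERATION SHARD A gen 34),
D10-HYBRID census node D10H-1b: soundness of the dimension-parametric SEEDCERT evaluator.
-/
import Literature.Probability.FitznerVanDerHofstad2017.SrwSeedCertSemanticsD
import Literature.Probability.FitznerVanDerHofstad2017.SrwSeedCertSound

/-!
# SEEDCERT kernel evaluator, dimension-parametric: soundness

The dimension-parametric companion of `SrwSeedCertSound`: **`Cert.soundD`** — if the four Boolean
checks `c.paramsOKD D`, `c.poissonCheckD D`, `c.tailCheckD D`, `c.finalCheckD D` of a seed certificate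
`c : SeedCert.Cert` hold, then for the lattice point `x ∈ ℤ^D` whose coordinates are `c.avalsD D`,
`lo n ≤ srwI D n 0 x ≤ hi n` for `n = 1, …, 4`.  The proof is the one of `Cert.sound` with the
dimension a parameter: the Bessel `u`-representation split at `T = t²`
(`srwI_succ_zero_eq_integral_Ioc_add_integral_Ioi`, which needs `2(n-1)+3 ≤ D`, granted by the
check `9 ≤ D`); on `(0,T]` the truncated Poisson-weighted walk sum `P_n - e^{-λ} U_n` (`λ = D t²`,
`Cert.PqD_real` / `Cert.UqD_real`) with the geometric majorant `R⁺_n` of the remainder (layer A of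
`SrwSeedCertSound`, imported: `exp_neg_nat_mem`, `tsum_choose_mul_poissonTail_le`); on `[T,∞)` the
product of the `D` per-coordinate brackets `L_a(1/u) ≤ √(2πu) q_u(a) ≤ U_a(1/u)`
(`srwHeatKernel_bracket_eps_coeffQ`, constant absorbed by `eps a`), the factor
`u^{n'} ∏_μ q_u = (2π)^{-D/2} · u^{n'-D/2} · ∏_μ √(2πu) q_u` and the termwise tail integrals
`∫_T^∞ u^{n'-D/2-i} du = 2/((D-2n'-2+2i) t^{D-2n'-2+2i})`, with `1/sHi^D ≤ (2π)^{-D/2} ≤ 1/sLo^D`.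
Generic lemmas (`loPoly_nonneg`, `list_prod_map_eq`, `cast_complSumQ`, `sq_rpow_J`, …) are imported
from `SrwSeedCertSound`; the per-coordinate bracket lemmas are re-proved over `Cert.ParamsD` because
`Cert.Params` fixes the padding length and `λ` at the literal dimension `11`.

[cite: FitznerVanDerHofstad2016NoBLE, §5.1.1 (5.4)–(5.5) pp. 1089–1090]
-/

namespace Literature.Probability.FitznerVanDerHofstad2017.SeedCert

open Real MeasureTheory Set Finset Polynomial
open Literature.Probability.LatticeModels (srwHeatKernel bracketCoeffQ complSum complSum_nonneg
  invSqrtCoeff_eq_cast srwHeatKernel_bracket_eps_coeffQ continuous_srwHeatKernel_left)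
open Literature.Probability.FitznerVanDerHofstad2017.SrwCount (coordD)
open Literature.Barriers.CriticalPhenomena.LongRangePhi4 (srwLaw srwLaw_nonneg srwLaw_le_one)
open scoped Nat

namespace Cert

variable (c : Cert) {D : ℕ} {x : Fin D → ℤ}

/-! ### Unpacking of the Boolean checks -/

/-- Unpacking of `poissonCheckD`. [cite: FitznerVanDerHofstad2016NoBLE, §5.1.1 (5.4)–(5.5) pp. 1089–1090] -/
theorem poissonCheckD_spec (h : c.poissonCheckD D = true) (n : ℕ) (hn1 : 1 ≤ n) (hn4 : n ≤ 4) :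
    c.pLo n ≤ c.PqD D (c.whatD D) n ∧ c.PqD D (c.whatD D) n ≤ c.pHi n ∧
      c.uLo n ≤ c.UqD D (c.whatD D) n ∧ c.UqD D (c.whatD D) n ≤ c.uHi n := by
  simp only [poissonCheckD, List.all_eq_true, List.mem_range, Bool.and_eq_true,
    decide_eq_true_eq] at h
  obtain ⟨⟨⟨a1, a2⟩, a3⟩, a4⟩ := h (n - 1) (by omega)
  rw [show n - 1 + 1 = n by omega] at a1 a2 a3 a4
  exact ⟨a1, a2, a3, a4⟩

/-- Unpacking of `tailCheckD`. [cite: FitznerVanDerHofstad2016NoBLE, §5.1.1 (5.4)–(5.5) pp. 1089–1090] -/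
theorem tailCheckD_spec (h : c.tailCheckD D = true) (n : ℕ) (hn1 : 1 ≤ n) (hn4 : n ≤ 4) :
    c.ilLo n ≤ c.tailOfD D (c.plPND D) n ∧ c.tailOfD D (c.puPND D) n ≤ c.iuHi n := by
  simp only [tailCheckD, List.all_eq_true, List.mem_range, Bool.and_eq_true,
    decide_eq_true_eq] at h
  obtain ⟨a1, a2⟩ := h (n - 1) (by omega)
  rw [show n - 1 + 1 = n by omega] at a1 a2
  exact ⟨a1, a2⟩

/-- Unpacking of `finalCheckD`. [cite: FitznerVanDerHofstad2016NoBLE, §5.1.1 (5.4)–(5.5) pp. 1089–1090] -/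
theorem finalCheckD_spec (h : c.finalCheckD D = true) (n : ℕ) (hn1 : 1 ≤ n) (hn4 : n ≤ 4) :
    0 ≤ c.uLo n ∧ 0 ≤ c.ilLo n ∧ c.lo n ≤ c.loFinalD D n ∧ c.hiFinalD D n ≤ c.hi n := by
  simp only [finalCheckD, List.all_eq_true, List.mem_range, Bool.and_eq_true,
    decide_eq_true_eq] at h
  obtain ⟨⟨⟨a1, a2⟩, a3⟩, a4⟩ := h (n - 1) (by omega)
  rw [show n - 1 + 1 = n by omega] at a1 a2 a3 a4
  exact ⟨a1, a2, a3, a4⟩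

/-! ### The `[0,T]` block -/

/-- `λ = D t²` in `ℝ`. [cite: FitznerVanDerHofstad2016NoBLE, §5.1.1 (5.4)–(5.5) pp. 1089–1090] -/
theorem cast_lamD (D : ℕ) : ((D : ℕ) : ℝ) * ((c.t : ℝ) ^ 2) = ((c.lamD D : ℕ) : ℝ) := by
  rw [Cert.lamD]; push_cast; ring

/-- The real form of `R⁺_{n'+1}`. [cite: FitznerVanDerHofstad2016NoBLE, §5.1.1 (5.4)–(5.5) pp. 1089–1090] -/
theorem RplusD_real (D n' : ℕ) :
    ((c.RplusD D (n' + 1) : ℚ) : ℝ) = ((c.rHiD D : ℚ) : ℝ) *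
      ((((c.M (n' + 1) : ℝ) + n' + 2) / ((c.M (n' + 1) : ℝ) + n' + 2 - (c.lamD D : ℝ)))
        * (((c.M (n' + 1) : ℝ) + 1) / ((c.M (n' + 1) : ℝ) + 1 - (c.lamD D : ℝ)))
        * (c.lamD D : ℝ) ^ (c.M (n' + 1) + n' + 1)
          / ((n' ! : ℝ) * ((c.M (n' + 1))! : ℝ) * ((c.M (n' + 1) : ℝ) + n' + 1))) := by
  rw [RplusD]
  push_cast
  ring

/-- **The `[0,T]` block**: with `B₀ = D^{n'+1}/n'! ∫_{(0,T]} u^{n'} ∏_μ q_u(x_μ) du`,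
`P - e^{-λ} U ≤ B₀ ≤ P - e^{-λ} U + R⁺`. [cite: FitznerVanDerHofstad2016NoBLE, §5.1.1 (5.4)–(5.5) pp. 1089–1090] -/
theorem ioc_blockD (hp : c.ParamsD D) (hcs : ∀ i, coordD x i = (((c.avalsD D).getD i 0 : ℕ) : ℤ))
    (n' : ℕ) (hn : n' ≤ 3) :
    ((c.PqD D (c.whatD D) (n' + 1) : ℚ) : ℝ)
        - Real.exp (-(c.lamD D : ℝ)) * ((c.UqD D (c.whatD D) (n' + 1) : ℚ) : ℝ)
      ≤ (D : ℝ) ^ (n' + 1) / (n' ! : ℝ)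
          * ∫ u in Ioc 0 ((c.t : ℝ) ^ 2), u ^ n' * ∏ μ : Fin D, srwHeatKernel u (x μ) ∧
    (D : ℝ) ^ (n' + 1) / (n' ! : ℝ)
          * ∫ u in Ioc 0 ((c.t : ℝ) ^ 2), u ^ n' * ∏ μ : Fin D, srwHeatKernel u (x μ)
      ≤ ((c.PqD D (c.whatD D) (n' + 1) : ℚ) : ℝ)
          - Real.exp (-(c.lamD D : ℝ)) * ((c.UqD D (c.whatD D) (n' + 1) : ℚ) : ℝ)
          + ((c.RplusD D (n' + 1) : ℚ) : ℝ) := by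
  have hn1 : 1 ≤ n' + 1 := by omega
  have hn4 : n' + 1 ≤ 4 := by omega
  have hT : (0 : ℝ) ≤ (c.t : ℝ) ^ 2 := by positivity
  have hd : 2 * n' + 3 ≤ D := by have := hp.hD; omega
  have hlam := c.cast_lamD D
  have hlam0 : (0 : ℝ) ≤ (c.lamD D : ℝ) := Nat.cast_nonneg _
  have hS : ∑ m ∈ range (c.M (n' + 1)), (((m + n').choose n' : ℕ) : ℝ) * srwLaw D m x
        * poissonTail ((c.lamD D : ℕ) : ℝ) (m + n' + 1)
      = ((c.PqD D (c.whatD D) (n' + 1) : ℚ) : ℝ)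
        - Real.exp (-(c.lamD D : ℝ)) * ((c.UqD D (c.whatD D) (n' + 1) : ℚ) : ℝ) := by
    rw [PqD_real hp hcs (n' + 1) hn1 hn4, UqD_real hp hcs (n' + 1) hn1 hn4]
    simp only [Nat.add_sub_cancel, poissonTail]
    rw [Finset.mul_sum, ← Finset.sum_sub_distrib]
    exact sum_congr rfl fun m _ => by ring
  have hlow := sum_choose_mul_srwLaw_mul_poissonTail_le n' hd x hT (c.M (n' + 1))
  rw [hlam, hS] at hlow
  have hMlt : (c.lamD D : ℝ) < (c.M (n' + 1) : ℝ) + 1 := by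
    have := hp.lam_lt (n' + 1) hn1 hn4
    exact_mod_cast (by omega : c.lamD D < c.M (n' + 1) + 1)
  obtain ⟨hsum, hbd⟩ := tsum_choose_mul_poissonTail_le hlam0 (c.M (n' + 1)) n' hMlt
  have hup := integral_Ioc_le_sum_add_of_hasSum n' hd x hT (c.M (n' + 1))
    (R := ∑' m : ℕ, (((m + c.M (n' + 1) + n').choose n' : ℕ) : ℝ)
      * poissonTail (c.lamD D : ℝ) (m + c.M (n' + 1) + n' + 1))
    (by rw [hlam]; exact hsum.hasSum)
  rw [hlam, hS] at hup
  refine ⟨by simpa using hlow, ?_⟩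
  have hR : ∑' m : ℕ, (((m + c.M (n' + 1) + n').choose n' : ℕ) : ℝ)
      * poissonTail (c.lamD D : ℝ) (m + c.M (n' + 1) + n' + 1) ≤ ((c.RplusD D (n' + 1) : ℚ) : ℝ) := by
    refine hbd.trans ?_
    rw [c.RplusD_real D n']
    obtain ⟨_, hrhi⟩ := exp_neg_nat_mem (c.lamD D) hp.eLo_nonneg
    have hrhi' : Real.exp (-(c.lamD D : ℝ)) ≤ ((c.rHiD D : ℚ) : ℝ) := by
      simpa [Cert.rHiD] using hrhi
    apply mul_le_mul_of_nonneg_right hrhi'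
    have h1 : (0 : ℝ) < (c.M (n' + 1) : ℝ) + n' + 2 - (c.lamD D : ℝ) := by
      linarith [(Nat.cast_nonneg n' : (0 : ℝ) ≤ n')]
    have h2 : (0 : ℝ) < (c.M (n' + 1) : ℝ) + 1 - (c.lamD D : ℝ) := by linarith
    positivity
  have := hup.trans (add_le_add le_rfl hR)
  simpa using this

/-! ### The `[T,∞)` block: per-coordinate brackets -/

/-- A coordinate value of the certificate lies in `avalsD`. [cite: FitznerVanDerHofstad2016NoBLE, §5.1.1 (5.4)–(5.5) pp. 1089–1090] -/
theorem getD_mem_avalsD (hp : c.ParamsD D) {i : ℕ} (hi : i < D) :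
    (c.avalsD D).getD i 0 ∈ c.avalsD D := by
  have hi' : i < (c.avalsD D).length := by rw [length_avalsD c D hp]; exact hi
  rw [List.getD_eq_getElem?_getD, List.getElem?_eq_getElem hi', Option.getD_some]
  exact List.getElem_mem hi'

/-- The coordinates of `x` are the (cast) `avalsD`. [cite: FitznerVanDerHofstad2016NoBLE, §5.1.1 (5.4)–(5.5) pp. 1089–1090] -/
theorem x_eqD (hcs : ∀ i, coordD x i = (((c.avalsD D).getD i 0 : ℕ) : ℤ)) (μ : Fin D) :
    x μ = (((c.avalsD D).getD μ.val 0 : ℕ) : ℤ) := by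
  have h := hcs μ.val
  simpa [coordD, μ.isLt] using h

/-- The bracket constant of `srwHeatKernel_bracket_eps_coeffQ` at `T₀ = t²` is at most `eps a`. [cite: FitznerVanDerHofstad2016NoBLE, §5.1.1 (5.4)–(5.5) pp. 1089–1090] -/
theorem bracketConst_leD (hp : c.ParamsD D) {a : ℕ} (ha : a ∈ c.avalsD D) :
    invSqrtCoeff (c.J + 1) / (1 - ((c.s0 : ℚ) : ℝ) ^ 2) * ((2 * c.J + 1)‼ : ℝ) / 4 ^ (c.J + 1)
      + √(2 * π) * Real.exp (-(2 * ((c.t : ℝ) ^ 2) * ((c.s0 : ℚ) : ℝ) ^ 2))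
        * ((c.t : ℝ) ^ 2) ^ ((c.J : ℝ) + 3 / 2)
        * (1 + 2 / π * ∑ i ∈ range (a + c.J + 1), |((bracketCoeffQ a c.J i : ℚ) : ℝ)|
            * (1 / (2 * ((c.s0 : ℚ) : ℝ)) * complSum i (((c.s0 : ℚ) : ℝ) ^ 2) (2 * (c.t : ℝ) ^ 2)))
      ≤ ((c.eps a : ℚ) : ℝ) := by
  have heps := hp.eps_ge a ha
  have heps' : ((epsBoundQ a c.J c.s0 c.t c.sHi c.nexp : ℚ) : ℝ) ≤ ((c.eps a : ℚ) : ℝ) := by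
    exact_mod_cast heps
  refine le_trans ?_ heps'
  rw [epsBoundQ]
  push_cast
  simp only [cast_complSumQ, cast_expPartialQ, ← invSqrtCoeff_eq_cast]
  push_cast
  have ht : (0 : ℝ) < (c.t : ℝ) := by exact_mod_cast hp.t_pos
  have hs0 : (0 : ℝ) < ((c.s0 : ℚ) : ℝ) := by exact_mod_cast hp.s0_pos
  rw [sq_rpow_J (c.t : ℝ) ht c.J]
  refine add_le_add le_rfl ?_
  have hSum0 : 0 ≤ ∑ i ∈ range (a + c.J + 1), |((bracketCoeffQ a c.J i : ℚ) : ℝ)|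
      * (1 / (2 * ((c.s0 : ℚ) : ℝ)) * complSum i (((c.s0 : ℚ) : ℝ) ^ 2) (2 * (c.t : ℝ) ^ 2)) := by
    apply sum_nonneg
    intro i _
    apply mul_nonneg (abs_nonneg _)
    apply mul_nonneg (by positivity)
    exact complSum_nonneg i (by positivity) (by positivity)
  have hsHi : √(2 * π) ≤ ((c.sHi : ℚ) : ℝ) := by
    have h1 : 2 * π ≤ ((c.sHi : ℚ) : ℝ) ^ 2 := by
      have := hp.sHi_sq
      have h2 : ((2 * piHi : ℚ) : ℝ) ≤ ((c.sHi ^ 2 : ℚ) : ℝ) := by exact_mod_cast this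
      push_cast at h2
      linarith [(show Real.pi < ((piHi : ℚ) : ℝ) from Literature.NumberTheory.LFunctions.lt_piHi20)]
    have hpos : (0 : ℝ) ≤ ((c.sHi : ℚ) : ℝ) := by exact_mod_cast hp.sHi_pos.le
    calc √(2 * π) ≤ √(((c.sHi : ℚ) : ℝ) ^ 2) := Real.sqrt_le_sqrt h1
      _ = ((c.sHi : ℚ) : ℝ) := Real.sqrt_sq hpos
  have hy : (0 : ℝ) ≤ 2 * (c.t : ℝ) ^ 2 * ((c.s0 : ℚ) : ℝ) ^ 2 := by positivity
  have hE0 : 0 < expPartial (2 * (c.t : ℝ) ^ 2 * ((c.s0 : ℚ) : ℝ) ^ 2) c.nexp := by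
    obtain ⟨k, hk⟩ : ∃ k, c.nexp = k + 1 := ⟨c.nexp - 1, by have := hp.nexp_pos; omega⟩
    rw [hk, expPartial, Finset.sum_range_succ']
    simp only [pow_zero, Nat.factorial_zero, Nat.cast_one, div_one]
    have : 0 ≤ ∑ i ∈ range k, (2 * (c.t : ℝ) ^ 2 * ((c.s0 : ℚ) : ℝ) ^ 2) ^ (i + 1) / ((i + 1)! : ℝ) :=
      sum_nonneg fun i _ => by positivity
    linarith
  have hexp : Real.exp (-(2 * (c.t : ℝ) ^ 2 * ((c.s0 : ℚ) : ℝ) ^ 2))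
      ≤ 1 / expPartial (2 * (c.t : ℝ) ^ 2 * ((c.s0 : ℚ) : ℝ) ^ 2) c.nexp := by
    rw [Real.exp_neg, ← one_div]
    exact one_div_le_one_div_of_le hE0 (expPartial_le_exp hy _)
  have hpi : 2 / π ≤ 2 / ((piLo : ℚ) : ℝ) :=
    div_le_div_of_nonneg_left (by norm_num) piLo_pos
      (show ((piLo : ℚ) : ℝ) < Real.pi from Literature.NumberTheory.LFunctions.piLo20_lt).le
  have hA : √(2 * π) * Real.exp (-(2 * (c.t : ℝ) ^ 2 * ((c.s0 : ℚ) : ℝ) ^ 2))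
      ≤ ((c.sHi : ℚ) : ℝ) * (1 / expPartial (2 * (c.t : ℝ) ^ 2 * ((c.s0 : ℚ) : ℝ) ^ 2) c.nexp) :=
    mul_le_mul hsHi hexp (Real.exp_nonneg _) (by exact_mod_cast hp.sHi_pos.le)
  have hB : 1 + 2 / π * ∑ i ∈ range (a + c.J + 1), |((bracketCoeffQ a c.J i : ℚ) : ℝ)|
        * (1 / (2 * ((c.s0 : ℚ) : ℝ)) * complSum i (((c.s0 : ℚ) : ℝ) ^ 2) (2 * (c.t : ℝ) ^ 2))
      ≤ 1 + 2 / ((piLo : ℚ) : ℝ) * ∑ i ∈ range (a + c.J + 1), |((bracketCoeffQ a c.J i : ℚ) : ℝ)|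
        * (1 / (2 * ((c.s0 : ℚ) : ℝ)) * complSum i (((c.s0 : ℚ) : ℝ) ^ 2) (2 * (c.t : ℝ) ^ 2)) :=
    add_le_add le_rfl (mul_le_mul_of_nonneg_right hpi hSum0)
  have hP0 : (0 : ℝ) ≤ ((c.t : ℝ) ^ 2) ^ (c.J + 1) * (c.t : ℝ) := by positivity
  have hB0 : (0 : ℝ) ≤ 1 + 2 / π * ∑ i ∈ range (a + c.J + 1), |((bracketCoeffQ a c.J i : ℚ) : ℝ)|
        * (1 / (2 * ((c.s0 : ℚ) : ℝ)) * complSum i (((c.s0 : ℚ) : ℝ) ^ 2) (2 * (c.t : ℝ) ^ 2)) := by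
    positivity
  calc √(2 * π) * Real.exp (-(2 * (c.t : ℝ) ^ 2 * ((c.s0 : ℚ) : ℝ) ^ 2))
        * (((c.t : ℝ) ^ 2) ^ (c.J + 1) * (c.t : ℝ)) * _
      ≤ ((c.sHi : ℚ) : ℝ) * (1 / expPartial (2 * (c.t : ℝ) ^ 2 * ((c.s0 : ℚ) : ℝ) ^ 2) c.nexp)
        * (((c.t : ℝ) ^ 2) ^ (c.J + 1) * (c.t : ℝ)) * _ := by
        apply mul_le_mul (mul_le_mul_of_nonneg_right hA hP0) hB hB0
        exact mul_nonneg (mul_nonneg (by exact_mod_cast hp.sHi_pos.le) (by positivity)) hP0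
    _ = _ := by ring

/-- **Per-coordinate bracket**: for `u ≥ t²`, `L_a(1/u) ≤ √(2πu) q_u(a) ≤ U_a(1/u)`. [cite: FitznerVanDerHofstad2016NoBLE, §5.1.1 (5.4)–(5.5) pp. 1089–1090] -/
theorem coord_bracketD (hp : c.ParamsD D) {a : ℕ} (ha : a ∈ c.avalsD D) {u : ℝ}
    (hu : (c.t : ℝ) ^ 2 ≤ u) :
    (toPolyQ (loList a c.J (c.eps a))).eval (1 / u) ≤ √(2 * π * u) * srwHeatKernel u (a : ℤ) ∧
      √(2 * π * u) * srwHeatKernel u (a : ℤ) ≤ (toPolyQ (upList a c.J (c.eps a))).eval (1 / u) := by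
  have ht : (0 : ℝ) < (c.t : ℝ) := by exact_mod_cast hp.t_pos
  have hu0 : 0 < u := lt_of_lt_of_le (by positivity) hu
  have hs0 : (0 : ℝ) < ((c.s0 : ℚ) : ℝ) := by exact_mod_cast hp.s0_pos
  have hs1 : ((c.s0 : ℚ) : ℝ) < 1 := by exact_mod_cast hp.s0_lt
  have hTc : ((c.J : ℝ) + 3 / 2) / (2 * ((c.s0 : ℚ) : ℝ) ^ 2) ≤ (c.t : ℝ) ^ 2 := by
    have h' := (Rat.cast_le (K := ℝ)).mpr hp.hT
    push_cast at h'
    exact h'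
  have hb := srwHeatKernel_bracket_eps_coeffQ (u := u) hs0 hs1 (a : ℤ) c.J hTc hu
  simp only [Int.natAbs_natCast] at hb
  have hC := c.bracketConst_leD hp ha
  have hmain : ∑ i ∈ range (a + c.J + 1),
        ((bracketCoeffQ a c.J i : ℚ) : ℝ) * ((2 * i - 1)‼ : ℝ) / (4 * u) ^ i
      = ∑ i ∈ range (a + c.J + 1), ((mcoef a c.J i : ℚ) : ℝ) * (1 / u) ^ i := by
    refine sum_congr rfl fun i _ => ?_
    rw [mcoef]; push_cast
    rw [mul_pow, one_div_pow]
    field_simp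
  rw [hmain] at hb
  have hw : (u ^ (c.J + 1))⁻¹ = (1 / u) ^ (c.J + 1) := by rw [one_div_pow, one_div]
  rw [hw] at hb
  have hw0 : (0 : ℝ) ≤ (1 / u) ^ (c.J + 1) := by positivity
  rw [abs_sub_le_iff] at hb
  obtain ⟨hb1, hb2⟩ := hb
  have hEw := mul_le_mul_of_nonneg_right hC hw0
  rw [eval_toPolyQ_loList, eval_toPolyQ_upList]
  constructor <;> nlinarith [hb1, hb2, hEw]

/-- The evaluated scaled product of the LOWER bracket polynomials. [cite: FitznerVanDerHofstad2016NoBLE, §5.1.1 (5.4)–(5.5) pp. 1089–1090] -/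
theorem plPND_eval (hp : c.ParamsD D) (w : ℝ) :
    (toPolyN (c.plPND D).1 - toPolyN (c.plPND D).2).eval w = (2 : ℝ) ^ (D * c.S)
      * ∏ μ : Fin D, (toPolyQ (loList ((c.avalsD D).getD μ.val 0) c.J
          (c.eps ((c.avalsD D).getD μ.val 0)))).eval w := by
  rw [Cert.plPND, toPolyN_loProdPN]
  have hcongr : ((c.avalsD D).map fun a => toPolyZ (loListZ a c.J (c.eps a) c.S))
      = (c.avalsD D).map fun a => C ((2 : ℝ) ^ c.S) * toPolyQ (loList a c.J (c.eps a)) := by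
    apply List.map_congr_left
    intro a ha
    exact toPolyZ_loListZ a c.J (c.eps a) c.S (List.all_eq_true.mpr (hp.lo_dy a ha))
  rw [hcongr, List.prod_map_mul, Polynomial.eval_mul, Polynomial.eval_list_prod,
    Polynomial.eval_list_prod, List.map_map, List.map_map]
  have h1 : ((c.avalsD D).map (eval w ∘ fun _ : ℕ => C ((2 : ℝ) ^ c.S))).prod
      = (2 : ℝ) ^ (D * c.S) := by
    rw [show (eval w ∘ fun _ : ℕ => C ((2 : ℝ) ^ c.S)) = fun _ => (2 : ℝ) ^ c.S by
      funext a; simp]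
    rw [List.map_const', List.prod_replicate, length_avalsD c D hp, ← pow_mul, mul_comm]
  rw [h1, list_prod_map_eq _ 0, length_avalsD c D hp, Finset.prod_range]
  rfl

/-- The evaluated scaled product of the UPPER bracket polynomials. [cite: FitznerVanDerHofstad2016NoBLE, §5.1.1 (5.4)–(5.5) pp. 1089–1090] -/
theorem puPND_eval (hp : c.ParamsD D) (w : ℝ) :
    (toPolyN (c.puPND D).1 - toPolyN (c.puPND D).2).eval w = (2 : ℝ) ^ (D * c.S)
      * ∏ μ : Fin D, (toPolyQ (upList ((c.avalsD D).getD μ.val 0) c.J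
          (c.eps ((c.avalsD D).getD μ.val 0)))).eval w := by
  rw [Cert.puPND, toPolyN_upProdPN]
  have hcongr : ((c.avalsD D).map fun a => toPolyZ (upListZ a c.J (c.eps a) c.S))
      = (c.avalsD D).map fun a => C ((2 : ℝ) ^ c.S) * toPolyQ (upList a c.J (c.eps a)) := by
    apply List.map_congr_left
    intro a ha
    exact toPolyZ_upListZ a c.J (c.eps a) c.S (List.all_eq_true.mpr (hp.up_dy a ha))
  rw [hcongr, List.prod_map_mul, Polynomial.eval_mul, Polynomial.eval_list_prod,
    Polynomial.eval_list_prod, List.map_map, List.map_map]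
  have h1 : ((c.avalsD D).map (eval w ∘ fun _ : ℕ => C ((2 : ℝ) ^ c.S))).prod
      = (2 : ℝ) ^ (D * c.S) := by
    rw [show (eval w ∘ fun _ : ℕ => C ((2 : ℝ) ^ c.S)) = fun _ => (2 : ℝ) ^ c.S by
      funext a; simp]
    rw [List.map_const', List.prod_replicate, length_avalsD c D hp, ← pow_mul, mul_comm]
  rw [h1, list_prod_map_eq _ 0, length_avalsD c D hp, Finset.prod_range]
  rfl

/-- **The product bracket** for `u ≥ t²`:
`PL(1/u)/2^{D S} ≤ ∏_μ √(2πu) q_u(x_μ) ≤ PU(1/u)/2^{D S}` and `0 ≤ PL(1/u)`. [cite: FitznerVanDerHofstad2016NoBLE, §5.1.1 (5.4)–(5.5) pp. 1089–1090] -/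
theorem prod_bracketD (hp : c.ParamsD D) (hcs : ∀ i, coordD x i = (((c.avalsD D).getD i 0 : ℕ) : ℤ))
    {u : ℝ} (hu : (c.t : ℝ) ^ 2 ≤ u) :
    (toPolyN (c.plPND D).1 - toPolyN (c.plPND D).2).eval (1 / u) / (2 : ℝ) ^ (D * c.S)
        ≤ ∏ μ : Fin D, (√(2 * π * u) * srwHeatKernel u (x μ)) ∧
      ∏ μ : Fin D, (√(2 * π * u) * srwHeatKernel u (x μ))
        ≤ (toPolyN (c.puPND D).1 - toPolyN (c.puPND D).2).eval (1 / u) / (2 : ℝ) ^ (D * c.S) ∧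
      0 ≤ (toPolyN (c.plPND D).1 - toPolyN (c.plPND D).2).eval (1 / u) / (2 : ℝ) ^ (D * c.S) := by
  have ht : (0 : ℝ) < (c.t : ℝ) := by exact_mod_cast hp.t_pos
  have hu0 : 0 < u := lt_of_lt_of_le (by positivity) hu
  have hw0 : (0 : ℝ) ≤ 1 / u := by positivity
  have hwh : 1 / u ≤ ((c.h : ℚ) : ℝ) := by
    rw [Cert.h]; push_cast
    exact one_div_le_one_div_of_le (by positivity) hu
  rw [c.plPND_eval hp, c.puPND_eval hp, mul_div_cancel_left₀ _ (by positivity),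
    mul_div_cancel_left₀ _ (by positivity)]
  simp only [c.x_eqD hcs]
  have hL0 : ∀ μ ∈ (univ : Finset (Fin D)),
      0 ≤ (toPolyQ (loList ((c.avalsD D).getD μ.val 0) c.J
        (c.eps ((c.avalsD D).getD μ.val 0)))).eval (1 / u) := by
    intro μ _
    exact loPoly_nonneg (hp.floor_nonneg _ (c.getD_mem_avalsD hp μ.isLt)) hw0 hwh
  have hbr : ∀ μ ∈ (univ : Finset (Fin D)),
      (toPolyQ (loList ((c.avalsD D).getD μ.val 0) c.J
          (c.eps ((c.avalsD D).getD μ.val 0)))).eval (1 / u)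
          ≤ √(2 * π * u) * srwHeatKernel u (((c.avalsD D).getD μ.val 0 : ℕ) : ℤ) ∧
        √(2 * π * u) * srwHeatKernel u (((c.avalsD D).getD μ.val 0 : ℕ) : ℤ)
          ≤ (toPolyQ (upList ((c.avalsD D).getD μ.val 0) c.J
            (c.eps ((c.avalsD D).getD μ.val 0)))).eval (1 / u) := by
    intro μ _
    exact c.coord_bracketD hp (c.getD_mem_avalsD hp μ.isLt) hu
  refine ⟨prod_le_prod hL0 fun i hi => (hbr i hi).1,
    prod_le_prod (fun i hi => ?_) fun i hi => (hbr i hi).2, prod_nonneg hL0⟩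
  exact (hL0 i hi).trans (hbr i hi).1

end Cert

/-! ### The `[T,∞)` block: the power integrals in dimension `D` -/

/-- `(√u)^D = u^{D/2}` (`u ≥ 0`). [folklore] -/
private theorem sqrt_pow_eq_rpow {u : ℝ} (hu : 0 ≤ u) (D : ℕ) : (√u) ^ D = u ^ ((D : ℝ) / 2) := by
  rw [Real.sqrt_eq_rpow, ← Real.rpow_natCast, ← Real.rpow_mul hu]
  congr 1; ring

/-- `u^{n'} (1/u)^i/(√u)^D = u^{n' - D/2 - i}` (`u > 0`). [folklore] -/
private theorem rpow_combineD {u : ℝ} (hu : 0 < u) (D n' i : ℕ) :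
    u ^ n' / (√u) ^ D * (1 / u) ^ i = u ^ ((n' : ℝ) - D / 2 - i) := by
  rw [sqrt_pow_eq_rpow hu.le,
    show (n' : ℝ) - D / 2 - i = (n' : ℝ) + (-((D : ℝ) / 2)) + (-(i : ℝ)) by ring,
    Real.rpow_add hu, Real.rpow_add hu, Real.rpow_neg hu.le, Real.rpow_neg hu.le,
    Real.rpow_natCast, Real.rpow_natCast, one_div, inv_pow]
  ring

/-- `∫_{t²}^∞ u^{n' - D/2 - i} du = 2/((D - 2n' - 2 + 2i) t^{D - 2n' - 2 + 2i})`
(`2n' + 3 ≤ D`, `t > 0`). [folklore] -/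
private theorem integral_rpow_tailD {t : ℝ} (ht : 0 < t) {D n' : ℕ} (hd : 2 * n' + 3 ≤ D) (i : ℕ) :
    ∫ u in Ioi (t ^ 2), u ^ ((n' : ℝ) - D / 2 - i)
      = 2 / ((((D - 2 * (n' + 1) + 2 * i : ℕ) : ℝ)) * t ^ (D - 2 * (n' + 1) + 2 * i)) := by
  have hnD : 2 * (n' : ℝ) + 3 ≤ (D : ℝ) := by exact_mod_cast hd
  have hi0 : (0 : ℝ) ≤ i := Nat.cast_nonneg i
  have ha : (n' : ℝ) - D / 2 - i < -1 := by linarith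
  rw [integral_Ioi_rpow_of_lt ha (by positivity)]
  have hk : ((D - 2 * (n' + 1) + 2 * i : ℕ) : ℝ) = (D : ℝ) - 2 * ((n' : ℝ) + 1) + 2 * i := by
    rw [Nat.cast_add, Nat.cast_sub (by omega)]; push_cast; ring
  have e1 : (t ^ 2) ^ ((n' : ℝ) - D / 2 - i + 1) = (t ^ (D - 2 * (n' + 1) + 2 * i))⁻¹ := by
    rw [← Real.rpow_two, ← Real.rpow_mul ht.le,
      show (2 : ℝ) * ((n' : ℝ) - D / 2 - i + 1) = -(((D - 2 * (n' + 1) + 2 * i : ℕ) : ℝ)) by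
        rw [hk]; ring,
      Real.rpow_neg ht.le, Real.rpow_natCast]
  rw [e1, hk, show (n' : ℝ) - D / 2 - i + 1 = -(((D : ℝ) - 2 * ((n' : ℝ) + 1) + 2 * i) / 2) by ring]
  have hne' : (D : ℝ) - 2 * ((n' : ℝ) + 1) + 2 * i ≠ 0 := by linarith
  have htk : t ^ (D - 2 * (n' + 1) + 2 * i) ≠ 0 := pow_ne_zero _ ht.ne'
  field_simp

/-- `u^{n'} ∏_μ q_u(x_μ) = ((√(2π))^D)⁻¹ · u^{n'}/(√u)^D · ∏_μ (√(2πu) q_u(x_μ))` (`u > 0`). [cite: FitznerVanDerHofstad2016NoBLE, §5.1.1 (5.4)–(5.5) pp. 1089–1090] -/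
theorem integrand_eqD {u : ℝ} (hu : 0 < u) (n' : ℕ) {D : ℕ} (x : Fin D → ℤ) :
    u ^ n' * ∏ μ : Fin D, srwHeatKernel u (x μ)
      = ((√(2 * π)) ^ D)⁻¹ * (u ^ n' / (√u) ^ D)
        * ∏ μ : Fin D, (√(2 * π * u) * srwHeatKernel u (x μ)) := by
  have hs : √(2 * π * u) = √(2 * π) * √u := Real.sqrt_mul (by positivity) u
  rw [prod_mul_distrib, prod_const, card_univ, Fintype.card_fin, hs, mul_pow (√(2 * π)) (√u) D]
  have h1 : (0 : ℝ) < (√(2 * π)) ^ D := by positivity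
  have h2 : (0 : ℝ) < (√u) ^ D := by positivity
  field_simp

namespace Cert

variable (c : Cert) {D : ℕ} {x : Fin D → ℤ}

/-- The real form of `tailOfD pl (n'+1)`. [cite: FitznerVanDerHofstad2016NoBLE, §5.1.1 (5.4)–(5.5) pp. 1089–1090] -/
theorem tailOfD_real (D : ℕ) (pl : List ℕ × List ℕ) (hl : pl.1.length = pl.2.length) (n' : ℕ) :
    ((c.tailOfD D pl (n' + 1) : ℚ) : ℝ) = ∑ i ∈ range pl.1.length,
      ((((pl.1.getD i 0 : ℕ) : ℝ) - ((pl.2.getD i 0 : ℕ) : ℝ)) / (2 : ℝ) ^ (D * c.S))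
        * (2 / ((((D - 2 * (n' + 1) + 2 * i : ℕ) : ℝ)) * (c.t : ℝ) ^ (D - 2 * (n' + 1) + 2 * i))) := by
  rw [Cert.tailOfD, tailInt_eq _ _ _ hl, Cert.scaleD]
  push_cast
  rw [Finset.sum_div]
  refine sum_congr rfl fun i _ => ?_
  ring

/-- **The `[T,∞)` block**: `kLo · IL ≤ ∫_{T}^∞ u^{n'} ∏_μ q_u(x_μ) du ≤ kHi · IU`. [cite: FitznerVanDerHofstad2016NoBLE, §5.1.1 (5.4)–(5.5) pp. 1089–1090] -/
theorem ioi_blockD (hp : c.ParamsD D) (hcs : ∀ i, coordD x i = (((c.avalsD D).getD i 0 : ℕ) : ℤ))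
    (n' : ℕ) (hn : n' ≤ 3) :
    ((c.kLoD D : ℚ) : ℝ) * ((c.ILD D (n' + 1) : ℚ) : ℝ)
        ≤ ∫ u in Ioi ((c.t : ℝ) ^ 2), u ^ n' * ∏ μ : Fin D, srwHeatKernel u (x μ) ∧
      ∫ u in Ioi ((c.t : ℝ) ^ 2), u ^ n' * ∏ μ : Fin D, srwHeatKernel u (x μ)
        ≤ ((c.kHiD D : ℚ) : ℝ) * ((c.IUD D (n' + 1) : ℚ) : ℝ) := by
  have ht : (0 : ℝ) < (c.t : ℝ) := by exact_mod_cast hp.t_pos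
  have hT0 : (0 : ℝ) < (c.t : ℝ) ^ 2 := by positivity
  have hd : 2 * n' + 3 ≤ D := by have := hp.hD; omega
  set κ : ℝ := ((√(2 * π)) ^ D)⁻¹ with hκ
  have hκ0 : 0 < κ := by positivity
  set g : ℝ → ℝ := fun u => u ^ n' * ∏ μ : Fin D, srwHeatKernel u (x μ) with hg
  set cL : ℕ → ℝ := fun i =>
    ((((c.plPND D).1.getD i 0 : ℕ) : ℝ) - (((c.plPND D).2.getD i 0 : ℕ) : ℝ)) / (2 : ℝ) ^ (D * c.S)
    with hcL
  set cU : ℕ → ℝ := fun i =>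
    ((((c.puPND D).1.getD i 0 : ℕ) : ℝ) - (((c.puPND D).2.getD i 0 : ℕ) : ℝ)) / (2 : ℝ) ^ (D * c.S)
    with hcU
  set fL : ℝ → ℝ := fun u => ∑ i ∈ range (c.plPND D).1.length,
    κ * cL i * u ^ ((n' : ℝ) - D / 2 - i) with hfL
  set fU : ℝ → ℝ := fun u => ∑ i ∈ range (c.puPND D).1.length,
    κ * cU i * u ^ ((n' : ℝ) - D / 2 - i) with hfU
  have hlenL : (c.plPND D).1.length = (c.plPND D).2.length :=
    length_loProdPN c.J c.eps c.S (c.avalsD D)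
  have hlenU : (c.puPND D).1.length = (c.puPND D).2.length :=
    length_upProdPN c.J c.eps c.S (c.avalsD D)
  have hfL_eq : ∀ u, (c.t : ℝ) ^ 2 < u → fL u = κ * (u ^ n' / (√u) ^ D)
      * ((toPolyN (c.plPND D).1 - toPolyN (c.plPND D).2).eval (1 / u) / (2 : ℝ) ^ (D * c.S)) := by
    intro u hu
    have hu0 : 0 < u := hT0.trans hu
    simp only [hfL]
    rw [eval_pair_sub _ _ hlenL, Finset.sum_div, Finset.mul_sum]
    refine sum_congr rfl fun i _ => ?_
    rw [hcL, ← rpow_combineD hu0 D n' i]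
    ring
  have hfU_eq : ∀ u, (c.t : ℝ) ^ 2 < u → fU u = κ * (u ^ n' / (√u) ^ D)
      * ((toPolyN (c.puPND D).1 - toPolyN (c.puPND D).2).eval (1 / u) / (2 : ℝ) ^ (D * c.S)) := by
    intro u hu
    have hu0 : 0 < u := hT0.trans hu
    simp only [hfU]
    rw [eval_pair_sub _ _ hlenU, Finset.sum_div, Finset.mul_sum]
    refine sum_congr rfl fun i _ => ?_
    rw [hcU, ← rpow_combineD hu0 D n' i]
    ring
  have hg_eq : ∀ u, (c.t : ℝ) ^ 2 < u → g u = κ * (u ^ n' / (√u) ^ D)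
      * ∏ μ : Fin D, (√(2 * π * u) * srwHeatKernel u (x μ)) := by
    intro u hu
    simp only [hg]
    exact integrand_eqD (hT0.trans hu) n' x
  have hle : ∀ u ∈ Ioi ((c.t : ℝ) ^ 2), fL u ≤ g u ∧ g u ≤ fU u ∧ 0 ≤ fL u := by
    intro u hu
    rw [Set.mem_Ioi] at hu
    have hu0 : 0 < u := hT0.trans hu
    obtain ⟨h1, h2, h3⟩ := c.prod_bracketD hp hcs hu.le
    have hfac : 0 ≤ κ * (u ^ n' / (√u) ^ D) := by positivity
    rw [hfL_eq u hu, hfU_eq u hu, hg_eq u hu]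
    exact ⟨mul_le_mul_of_nonneg_left h1 hfac, mul_le_mul_of_nonneg_left h2 hfac,
      mul_nonneg hfac h3⟩
  -- integrability
  have hnD : 2 * (n' : ℝ) + 3 ≤ (D : ℝ) := by exact_mod_cast hd
  have hintpow : ∀ i : ℕ, IntegrableOn (fun u : ℝ => u ^ ((n' : ℝ) - D / 2 - i))
      (Ioi ((c.t : ℝ) ^ 2)) := by
    intro i
    have hi0 : (0 : ℝ) ≤ i := Nat.cast_nonneg i
    exact integrableOn_Ioi_rpow_of_lt (by linarith) hT0
  have hfL_int : IntegrableOn fL (Ioi ((c.t : ℝ) ^ 2)) := by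
    rw [hfL]
    refine integrable_finsetSum _ fun i _ => ?_
    exact (hintpow i).const_mul _
  have hfU_int : IntegrableOn fU (Ioi ((c.t : ℝ) ^ 2)) := by
    rw [hfU]
    refine integrable_finsetSum _ fun i _ => ?_
    exact (hintpow i).const_mul _
  have hg_cont : Continuous g := by
    rw [hg]
    exact (continuous_id.pow n').mul
      (continuous_finsetProd _ fun μ _ => continuous_srwHeatKernel_left (x μ))
  have hg_int : IntegrableOn g (Ioi ((c.t : ℝ) ^ 2)) := by
    refine Integrable.mono' hfU_int hg_cont.aestronglyMeasurable ?_
    refine ae_restrict_of_forall_mem measurableSet_Ioi fun u hu => ?_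
    obtain ⟨h1, h2, h3⟩ := hle u hu
    rw [Real.norm_eq_abs, abs_of_nonneg (h3.trans h1)]
    exact h2
  -- the integrals of the minorant / majorant
  have hIL : ∫ u in Ioi ((c.t : ℝ) ^ 2), fL u = κ * ((c.ILD D (n' + 1) : ℚ) : ℝ) := by
    rw [hfL, integral_finsetSum _ (fun i _ => (hintpow i).const_mul _)]
    simp_rw [integral_const_mul, integral_rpow_tailD ht hd]
    rw [Cert.ILD, c.tailOfD_real D (c.plPND D) hlenL n', Finset.mul_sum]
    refine sum_congr rfl fun i _ => ?_
    rw [hcL]; ring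
  have hIU : ∫ u in Ioi ((c.t : ℝ) ^ 2), fU u = κ * ((c.IUD D (n' + 1) : ℚ) : ℝ) := by
    rw [hfU, integral_finsetSum _ (fun i _ => (hintpow i).const_mul _)]
    simp_rw [integral_const_mul, integral_rpow_tailD ht hd]
    rw [Cert.IUD, c.tailOfD_real D (c.puPND D) hlenU n', Finset.mul_sum]
    refine sum_congr rfl fun i _ => ?_
    rw [hcU]; ring
  have hlowI : κ * ((c.ILD D (n' + 1) : ℚ) : ℝ) ≤ ∫ u in Ioi ((c.t : ℝ) ^ 2), g u := by
    rw [← hIL]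
    exact setIntegral_mono_on hfL_int hg_int measurableSet_Ioi fun u hu => (hle u hu).1
  have hupI : ∫ u in Ioi ((c.t : ℝ) ^ 2), g u ≤ κ * ((c.IUD D (n' + 1) : ℚ) : ℝ) := by
    rw [← hIU]
    exact setIntegral_mono_on hg_int hfU_int measurableSet_Ioi fun u hu => (hle u hu).2.1
  have hIL0 : 0 ≤ ((c.ILD D (n' + 1) : ℚ) : ℝ) := by
    have h0 : 0 ≤ ∫ u in Ioi ((c.t : ℝ) ^ 2), fL u :=
      setIntegral_nonneg measurableSet_Ioi fun u hu => (hle u hu).2.2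
    rw [hIL] at h0
    by_contra hneg
    push Not at hneg
    have := mul_neg_of_pos_of_neg hκ0 hneg
    linarith
  have hIU0 : 0 ≤ ((c.IUD D (n' + 1) : ℚ) : ℝ) := by
    have h0 : 0 ≤ ∫ u in Ioi ((c.t : ℝ) ^ 2), g u :=
      setIntegral_nonneg measurableSet_Ioi fun u hu => (hle u hu).2.2.trans (hle u hu).1
    have h1 := h0.trans hupI
    by_contra hneg
    push Not at hneg
    have := mul_neg_of_pos_of_neg hκ0 hneg
    linarith
  -- the `(2π)^{-D/2}` brackets
  have hsHi : √(2 * π) ≤ ((c.sHi : ℚ) : ℝ) := by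
    have h1 : 2 * π ≤ ((c.sHi : ℚ) : ℝ) ^ 2 := by
      have h2 : ((2 * piHi : ℚ) : ℝ) ≤ ((c.sHi ^ 2 : ℚ) : ℝ) := by exact_mod_cast hp.sHi_sq
      push_cast at h2
      linarith [(show Real.pi < ((piHi : ℚ) : ℝ) from Literature.NumberTheory.LFunctions.lt_piHi20)]
    calc √(2 * π) ≤ √(((c.sHi : ℚ) : ℝ) ^ 2) := Real.sqrt_le_sqrt h1
      _ = ((c.sHi : ℚ) : ℝ) := Real.sqrt_sq (by exact_mod_cast hp.sHi_pos.le)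
  have hsLo : ((c.sLo : ℚ) : ℝ) ≤ √(2 * π) := by
    have h1 : ((c.sLo : ℚ) : ℝ) ^ 2 ≤ 2 * π := by
      have h2 : ((c.sLo ^ 2 : ℚ) : ℝ) ≤ ((2 * piLo : ℚ) : ℝ) := by exact_mod_cast hp.sLo_sq
      push_cast at h2
      linarith [(show ((piLo : ℚ) : ℝ) < Real.pi from Literature.NumberTheory.LFunctions.piLo20_lt)]
    calc ((c.sLo : ℚ) : ℝ) = √(((c.sLo : ℚ) : ℝ) ^ 2) :=
          (Real.sqrt_sq (by exact_mod_cast hp.sLo_pos.le)).symm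
      _ ≤ √(2 * π) := Real.sqrt_le_sqrt h1
  have hsHi0 : (0 : ℝ) < ((c.sHi : ℚ) : ℝ) := by exact_mod_cast hp.sHi_pos
  have hsLo0 : (0 : ℝ) < ((c.sLo : ℚ) : ℝ) := by exact_mod_cast hp.sLo_pos
  have hkLo : ((c.kLoD D : ℚ) : ℝ) ≤ κ := by
    rw [Cert.kLoD, hκ]; push_cast
    rw [← one_div]
    apply one_div_le_one_div_of_le (by positivity)
    exact pow_le_pow_left₀ (by positivity) hsHi D
  have hkHi : κ ≤ ((c.kHiD D : ℚ) : ℝ) := by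
    rw [Cert.kHiD, hκ]; push_cast
    rw [← one_div]
    apply one_div_le_one_div_of_le (by positivity)
    exact pow_le_pow_left₀ hsLo0.le hsLo D
  constructor
  · calc ((c.kLoD D : ℚ) : ℝ) * ((c.ILD D (n' + 1) : ℚ) : ℝ) ≤ κ * ((c.ILD D (n' + 1) : ℚ) : ℝ) :=
          mul_le_mul_of_nonneg_right hkLo hIL0
      _ ≤ _ := hlowI
  · calc ∫ u in Ioi ((c.t : ℝ) ^ 2), g u ≤ κ * ((c.IUD D (n' + 1) : ℚ) : ℝ) := hupI
      _ ≤ ((c.kHiD D : ℚ) : ℝ) * ((c.IUD D (n' + 1) : ℚ) : ℝ) :=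
          mul_le_mul_of_nonneg_right hkHi hIU0

/-! ### The soundness theorem -/

/-- **Soundness of the dimension-parametric SEEDCERT certificate**: if the four Boolean checks hold
at dimension `D`, then for the lattice point `x ∈ ℤ^D` whose coordinates are the certificate's
`avalsD D`, `lo n ≤ I_{n,0}(x; D) ≤ hi n` for `n = 1, …, 4`. [cite: FitznerVanDerHofstad2016NoBLE, §5.1.1 (5.4)–(5.5) pp. 1089–1090] -/
theorem soundD (D : ℕ) (h1 : c.paramsOKD D = true) (h2 : c.poissonCheckD D = true)
    (h3 : c.tailCheckD D = true) (h4 : c.finalCheckD D = true) (x : Fin D → ℤ)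
    (hcs : ∀ i, coordD x i = (((c.avalsD D).getD i 0 : ℕ) : ℤ)) (n : ℕ) (hn1 : 1 ≤ n)
    (hn4 : n ≤ 4) :
    ((c.lo n : ℚ) : ℝ) ≤ srwI D n 0 x ∧ srwI D n 0 x ≤ ((c.hi n : ℚ) : ℝ) := by
  have hp := c.paramsD_of_paramsOKD D h1
  obtain ⟨n', rfl⟩ : ∃ n', n = n' + 1 := ⟨n - 1, by omega⟩
  have hn : n' ≤ 3 := by omega
  have hT : (0 : ℝ) ≤ (c.t : ℝ) ^ 2 := by positivity
  have hd : 2 * n' + 3 ≤ D := by have := hp.hD; omega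
  have hsplit := srwI_succ_zero_eq_integral_Ioc_add_integral_Ioi n' hd x hT
  obtain ⟨hB0lo, hB0hi⟩ := c.ioc_blockD hp hcs n' hn
  obtain ⟨hB1lo, hB1hi⟩ := c.ioi_blockD hp hcs n' hn
  obtain ⟨hPlo, hPhi, hUlo, hUhi⟩ := c.poissonCheckD_spec h2 (n' + 1) (by omega) (by omega)
  obtain ⟨hILlo, hIUhi⟩ := c.tailCheckD_spec h3 (n' + 1) (by omega) (by omega)
  obtain ⟨hu0, hil0, hlo, hhi⟩ := c.finalCheckD_spec h4 (n' + 1) (by omega) (by omega)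
  obtain ⟨hrlo, hrhi⟩ := exp_neg_nat_mem (c.lamD D) hp.eLo_nonneg
  have hrlo' : ((c.rLoD D : ℚ) : ℝ) ≤ Real.exp (-(c.lamD D : ℝ)) := by
    simpa [Cert.rLoD] using hrlo
  have hrhi' : Real.exp (-(c.lamD D : ℝ)) ≤ ((c.rHiD D : ℚ) : ℝ) := by
    simpa [Cert.rHiD] using hrhi
  -- casts of the rational facts
  have qPlo : ((c.pLo (n' + 1) : ℚ) : ℝ) ≤ ((c.PqD D (c.whatD D) (n' + 1) : ℚ) : ℝ) := by
    exact_mod_cast hPlo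
  have qPhi : ((c.PqD D (c.whatD D) (n' + 1) : ℚ) : ℝ) ≤ ((c.pHi (n' + 1) : ℚ) : ℝ) := by
    exact_mod_cast hPhi
  have qUlo : ((c.uLo (n' + 1) : ℚ) : ℝ) ≤ ((c.UqD D (c.whatD D) (n' + 1) : ℚ) : ℝ) := by
    exact_mod_cast hUlo
  have qUhi : ((c.UqD D (c.whatD D) (n' + 1) : ℚ) : ℝ) ≤ ((c.uHi (n' + 1) : ℚ) : ℝ) := by
    exact_mod_cast hUhi
  have qILlo : ((c.ilLo (n' + 1) : ℚ) : ℝ) ≤ ((c.ILD D (n' + 1) : ℚ) : ℝ) := by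
    rw [Cert.ILD]; exact_mod_cast hILlo
  have qIUhi : ((c.IUD D (n' + 1) : ℚ) : ℝ) ≤ ((c.iuHi (n' + 1) : ℚ) : ℝ) := by
    rw [Cert.IUD]; exact_mod_cast hIUhi
  have qu0 : (0 : ℝ) ≤ ((c.uLo (n' + 1) : ℚ) : ℝ) := by exact_mod_cast hu0
  have qil0 : (0 : ℝ) ≤ ((c.ilLo (n' + 1) : ℚ) : ℝ) := by exact_mod_cast hil0
  have qlo : ((c.lo (n' + 1) : ℚ) : ℝ) ≤ ((c.loFinalD D (n' + 1) : ℚ) : ℝ) := by exact_mod_cast hlo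
  have qhi : ((c.hiFinalD D (n' + 1) : ℚ) : ℝ) ≤ ((c.hi (n' + 1) : ℚ) : ℝ) := by exact_mod_cast hhi
  rw [Cert.loFinalD, Cert.prefD] at qlo
  rw [Cert.hiFinalD, Cert.prefD] at qhi
  push_cast at qlo qhi
  -- signs
  have he0 : 0 ≤ Real.exp (-(c.lamD D : ℝ)) := Real.exp_nonneg _
  have hU0 : 0 ≤ ((c.UqD D (c.whatD D) (n' + 1) : ℚ) : ℝ) := qu0.trans qUlo
  have hkLo0 : 0 ≤ ((c.kLoD D : ℚ) : ℝ) := by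
    rw [Cert.kLoD]; push_cast
    have : (0 : ℝ) < ((c.sHi : ℚ) : ℝ) := by exact_mod_cast hp.sHi_pos
    positivity
  have hkHi0 : 0 ≤ ((c.kHiD D : ℚ) : ℝ) := by
    rw [Cert.kHiD]; push_cast
    have : (0 : ℝ) < ((c.sLo : ℚ) : ℝ) := by exact_mod_cast hp.sLo_pos
    positivity
  have hpref0 : (0 : ℝ) ≤ (D : ℝ) ^ (n' + 1) / (n' ! : ℝ) := by positivity
  -- product facts for `linarith`
  have hA : Real.exp (-(c.lamD D : ℝ)) * ((c.UqD D (c.whatD D) (n' + 1) : ℚ) : ℝ)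
      ≤ ((c.rHiD D : ℚ) : ℝ) * ((c.uHi (n' + 1) : ℚ) : ℝ) :=
    mul_le_mul hrhi' qUhi hU0 (he0.trans hrhi')
  have hB : ((c.rLoD D : ℚ) : ℝ) * ((c.uLo (n' + 1) : ℚ) : ℝ)
      ≤ Real.exp (-(c.lamD D : ℝ)) * ((c.UqD D (c.whatD D) (n' + 1) : ℚ) : ℝ) :=
    mul_le_mul hrlo' qUlo qu0 he0
  have hC : (D : ℝ) ^ (n' + 1) / (n' ! : ℝ) * (((c.kLoD D : ℚ) : ℝ) * ((c.ilLo (n' + 1) : ℚ) : ℝ))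
      ≤ (D : ℝ) ^ (n' + 1) / (n' ! : ℝ)
        * ∫ u in Ioi ((c.t : ℝ) ^ 2), u ^ n' * ∏ μ : Fin D, srwHeatKernel u (x μ) := by
    apply mul_le_mul_of_nonneg_left _ hpref0
    exact (mul_le_mul_of_nonneg_left qILlo hkLo0).trans hB1lo
  have hD' : (D : ℝ) ^ (n' + 1) / (n' ! : ℝ)
        * ∫ u in Ioi ((c.t : ℝ) ^ 2), u ^ n' * ∏ μ : Fin D, srwHeatKernel u (x μ)
      ≤ (D : ℝ) ^ (n' + 1) / (n' ! : ℝ) * (((c.kHiD D : ℚ) : ℝ) * ((c.iuHi (n' + 1) : ℚ) : ℝ)) := by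
    apply mul_le_mul_of_nonneg_left _ hpref0
    exact hB1hi.trans (mul_le_mul_of_nonneg_left qIUhi hkHi0)
  rw [hsplit]
  constructor <;> linarith

end Cert

end Literature.Probability.FitznerVanDerHofstad2017.SeedCert
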